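import Summits.BirchSwinnertonDyer.BirchSwinnertonDyer.Theses.ShaPrimaryTransfer
import Literature.NumberTheory.EllipticCurves.XCubeAdd2465SqThreeDescent

/-!
# BirchSwinnertonDyer / ShaPrimaryTransfer — crux `FiniteShaComponentTransfer` (stmt-BirchSwinnertonDyer-22356):
# THE DOOR AT 3, CLASS-WIDE AND AT RANK 3 — `rank(y² = x³ + t²) ≤ ω(t)` for every odd `t` with all prime factors
# `≡ 2 (mod 3)`, sharpness ⇒ `t_3 = 0` at rank `ω(t)`; instance `t = 2465`: rank `3`, `Ш[3^∞] = 0`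

Route `ShaPrimaryTransfer` (D-0145 LINE 2): T = `FiniteShaComponentTransfer` (stmt-22356: «`t_p(E) = 0 ⟹ t_q(E) = 0`»,
`t_p(E) = corank_{ℤ_p} Ш(E)[p^∞]`), O = `OneFiniteShaComponent` (stmt-22357: «some prime `p₀` — 2 AND 3 allowed — with
`t_{p₀}(E) = 0`», decided curve by curve by `p₀`-descent). The doors certified so far: at `p₀ = 2` through rank `7`
(g0–g5), at `p₀ = 3` at rank `2` (g6: `y² = x³ − 27·55²`, and the class `t = pq`). This helper file (prover seat
`bsd-line-spt-p1` g7, `--supports stmt-22356 --as helper`) records, UNCONDITIONALLY (standard axioms, no named fact):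

* §1 **the class-wide door at 3** (tree `Literature/NumberTheory/EllipticCurves/XCubeAddTSqThreeDescent.lean`, `MordellT`):
  for EVERY odd `t ≠ 0` all of whose prime factors are `≡ 2 (mod 3)`, `rank(y² = x³ + t²)(ℚ) ≤ ω(t)` (the `√−3`-Selmer box
  `⟨[q] : q ∣ 2t⟩ ⊂ ℚ(ζ₃)ˣ/ℚ(ζ₃)ˣ³`, `3^{ω(t)+1}` classes, `K(S,3)` of `ℚ(ζ₃)` for `S = {λ} ∪ {q ∣ 2t}`), and the SHARPNESS
  CRITERION: if every `[q]`, `q ∣ 2t`, is a descent value of a `ℚ(ζ₃)`-point of `A' : Y² = X³ + (27t)²` then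
  `E_t : y² = x³ − 27t²` has `rank = ω(t)`, `Ш(E_t/ℚ)[3^∞] = 0`, `t_3(E_t) = 0`, `corank Sel_{3^∞} = ω(t)` — read here through
  O and T BY NAME (`oneFiniteShaComponent_of_generators`, `selmerCorank_eq_of_transfer_of_generators`);
* §2 **the door at 3 at RANK 3** (tree `XCubeAdd2465SqThreeDescent.lean`, `Mordell2465`): `t = 2465 = 5·17·29`, the box
  `⟨[2],[5],[17],[29]⟩` is filled by four rational points, so `E : y² = x³ − 27·2465² = x³ − 164058075` has
  **`rank E(ℚ) = 3`, `Ш(E/ℚ)[3^∞] = 0`, `t_3(E) = 0`, `corank_{ℤ₃} Sel_{3^∞}(E/ℚ) = 3`** — the first rank-3 door at an odd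
  prime in the tree (`door_at_three_rank_three`, `exists_door_at_three_rank_three`, `oneFiniteShaComponent_2465`);
* §3 the cell `(E, 3, q)` read through T: `shaCorank_2465_eq_zero_of_transfer` (T ⟹ `t_q(E) = 0` ∀ `q`, e.g. `t_2(E) = 0`,
  which no instrument in the tree decides: `E` has no rational `2`-torsion), `selmerCorank_2465_eq_three_of_transfer`,
  `transfer_at_door_three_rank_three`.

Nothing here proves T, O or BSD; T remains conjecture-grade at rank ≥ 2 (its CONCLUSION is certified for no curve of
rank ≥ 2). References: K. Jeong, Proc. Japan Acad. 95 (2019), §3; H. Cohen, F. Pazuki, Acta Arith. 140 (2009), Thm. 2.1,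
§5; J. H. Silverman, *AEC* 2nd ed., X.4; R. Greenberg, LNM 1716 (1999), §1.
-/

-- D-0017: single-problem summit, so `Summit.BirchSwinnertonDyer.BirchSwinnertonDyer.…` repeats a namespace BY DESIGN.
set_option linter.dupNamespace false

noncomputable section

namespace Summit.BirchSwinnertonDyer.BirchSwinnertonDyer.Theorems.ShaPrimaryTransferDoorAtThreeRankThree

open scoped Classical
open Literature.NumberTheory.EllipticCurves
open WeierstrassCurve
open Summit.BirchSwinnertonDyer.BirchSwinnertonDyer.Theses.ShaPrimaryTransfer (FiniteShaComponentTransfer OneFiniteShaComponent)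
open Literature.NumberTheory.NumberFields (K3)

/-! ## §1 The class-wide door at 3, read through O and T -/

section ClassWide

variable {t : ℕ} [NeZero t] (hodd : ¬ 2 ∣ t) (hinert : ∀ q ∈ t.primeFactors, q % 3 = 2)
  (hgen : ∀ q ∈ (2 * t).primeFactors, MordellDescent.cubeClass ((q : ℕ) : K3) ∈
    Set.range (fun P : (mordellCurve (81 * ((3 * t : ℕ) : K3) ^ 2)).toAffine.Point =>
      MordellDescent.cubeClass (MordellDescent.phiDescent ((3 * t : ℕ) : K3) P)))

include hodd hinert in
/-- **The class-wide rank bound behind the door at 3**: `rank(y² = x³ + t²)(ℚ) ≤ ω(t)` and `rank(y² = x³ − 27t²)(ℚ) ≤ ω(t)`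
for every odd `t` all of whose prime factors are `≡ 2 (mod 3)` — UNCONDITIONAL (tree `MordellT.mordellWeilRank_le_card_primeFactors`).
[cite: Jeong2019RankExactlyTwoII, Prop. 3.5] -/
theorem mordellWeilRank_le_omega :
    (mordellCurve (((t : ℕ) : ℚ) ^ 2)).mordellWeilRank ≤ t.primeFactors.card ∧
      (mordellCurve (-27 * ((t : ℕ) : ℚ) ^ 2)).mordellWeilRank ≤ t.primeFactors.card :=
  ⟨MordellT.mordellWeilRank_le_card_primeFactors hodd hinert, MordellT.mordellWeilRank_twist_le_card_primeFactors hodd hinert⟩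

include hodd hinert hgen in
/-- **O class-wide at the door 3**: for every sharp `t` (all `[q]`, `q ∣ 2t`, realised by descent values), the curve
`E_t : y² = x³ − 27t²` — of rank `ω(t)` — satisfies `OneFiniteShaComponent` with witness the odd prime `p₀ = 3`.
UNCONDITIONAL. [cite: CohenPazuki2009, Thm. 2.1] -/
theorem oneFiniteShaComponent_of_generators :
    ∃ (p : ℕ) (_ : Fact p.Prime), (mordellCurve (-27 * ((t : ℕ) : ℚ) ^ 2)).shaCorank p = 0 :=
  ⟨3, ⟨Nat.prime_three⟩, (MordellT.shaCorank_three_eq_zero hodd hinert hgen).1⟩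

include hodd hinert hgen in
/-- **T class-wide at the door 3**: granting T, every sharp `E_t : y² = x³ − 27t²` has `t_q(E_t) = 0` and
`corank_{ℤ_q} Sel_{q^∞}(E_t/ℚ) = ω(t)` at EVERY prime `q` (unconditional at `q = 3`; at `q ≠ 3` exactly what T asserts).
[cite: Greenberg1999LNM, §1 pp. 54–57] -/
theorem selmerCorank_eq_of_transfer_of_generators (hT : FiniteShaComponentTransfer) (q : ℕ) [Fact q.Prime] :
    (mordellCurve (-27 * ((t : ℕ) : ℚ) ^ 2)).shaCorank q = 0 ∧
      (mordellCurve (-27 * ((t : ℕ) : ℚ) ^ 2)).selmerCorank q = t.primeFactors.card := by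
  haveI : (mordellCurve (-27 * ((t : ℕ) : ℚ) ^ 2)).IsElliptic :=
    isElliptic_mordellCurve (mul_ne_zero (by norm_num) (pow_ne_zero 2 (by exact_mod_cast NeZero.ne t)))
  haveI : Fact (Nat.Prime 3) := ⟨Nat.prime_three⟩
  obtain ⟨hr, h3, -, -⟩ := MordellT.door_at_three_of_generators hodd hinert hgen
  have hq : (mordellCurve (-27 * ((t : ℕ) : ℚ) ^ 2)).shaCorank q = 0 := hT _ 3 q h3
  refine ⟨hq, ?_⟩
  rw [(mordellCurve (-27 * ((t : ℕ) : ℚ) ^ 2)).selmerCorank_eq_mordellWeilRank_add_holds q, hr, hq, add_zero]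

end ClassWide

/-! ## §2 The door at 3 at rank 3: `E : y² = x³ − 27·2465²` -/

/-- **THE DOOR AT 3 AT RANK 3: `rank E(ℚ) = 3` and `t_3(E) = corank_{ℤ₃} Ш(E/ℚ)[3^∞] = 0`** for
`E : y² = x³ − 27·2465² = x³ − 164058075` — UNCONDITIONAL (complete `√−3`-descent over `ℚ(ζ₃)`; tree
`Mordell2465.mordellWeilRank_curve`, `Mordell2465.shaCorank_three`). [cite: Jeong2019RankExactlyTwoII, Prop. 3.5] [cite: CohenPazuki2009, Thm. 2.1] -/
theorem door_at_three_rank_three :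
    (mordellCurve (-27 * ((2465 : ℕ) : ℚ) ^ 2)).mordellWeilRank = 3 ∧
      (mordellCurve (-27 * ((2465 : ℕ) : ℚ) ^ 2)).shaCorank 3 = 0 :=
  ⟨Mordell2465.mordellWeilRank_curve.2, Mordell2465.shaCorank_three⟩

/-- **`rank(y² = x³ + 2465²)(ℚ) = 3`** (Jeong's model `A_t`, `ℚ`-isomorphic to `Y² = X³ + (27·2465)²` and `3`-isogenous to `E`).
[cite: Jeong2019RankExactlyTwoII, Prop. 3.5] -/
theorem mordellWeilRank_2465 : (mordellCurve (((2465 : ℕ) : ℚ) ^ 2)).mordellWeilRank = 3 :=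
  Mordell2465.mordellWeilRank_curve.1

/-- **`corank_{ℤ₃} Sel_{3^∞}(E/ℚ) = rank E(ℚ) = 3`** — T's hypothesis in Selmer coordinates at `p = 3`, rank `3`.
[cite: Greenberg1999LNM, §1 pp. 54–57] -/
theorem selmerCorank_three_eq_rank :
    (mordellCurve (-27 * ((2465 : ℕ) : ℚ) ^ 2)).selmerCorank 3 = 3 ∧
      (mordellCurve (-27 * ((2465 : ℕ) : ℚ) ^ 2)).selmerCorank 3 =
        (mordellCurve (-27 * ((2465 : ℕ) : ℚ) ^ 2)).mordellWeilRank :=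
  ⟨Mordell2465.selmerCorank_three, by rw [Mordell2465.selmerCorank_three, Mordell2465.mordellWeilRank_curve.2]⟩

/-- **O holds for `E`** (rank 3), with witness the ODD prime `p₀ = 3` (an instance of the crux `OneFiniteShaComponent`,
stmt-22357, decided by `3`-descent). UNCONDITIONAL. [cite: CohenPazuki2009, Thm. 2.1] -/
theorem oneFiniteShaComponent_2465 :
    ∃ (p : ℕ) (_ : Fact p.Prime), (mordellCurve (-27 * ((2465 : ℕ) : ℚ) ^ 2)).shaCorank p = 0 :=
  ⟨3, ⟨Nat.prime_three⟩, Mordell2465.shaCorank_three⟩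

/-- **Existence form**: there is an elliptic curve over `ℚ` of Mordell–Weil rank `3` whose door at `3` is open —
`t_3 = 0`, `Ш[3^∞] = 0`, `corank Sel_{3^∞} = 3` — certified by descent at `3` alone.
[cite: Jeong2019RankExactlyTwoII, Prop. 3.5] -/
theorem exists_door_at_three_rank_three :
    ∃ W : WeierstrassCurve ℚ, W.IsElliptic ∧ W.mordellWeilRank = 3 ∧ W.shaCorank 3 = 0 ∧
      AddCommGroup.primaryComponent W.sha 3 = ⊥ ∧ W.selmerCorank 3 = 3 :=
  ⟨mordellCurve (-27 * ((2465 : ℕ) : ℚ) ^ 2), Mordell2465.isElliptic_curve, Mordell2465.mordellWeilRank_curve.2,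
    Mordell2465.shaCorank_three, Mordell2465.primaryComponent_sha_three, Mordell2465.selmerCorank_three⟩

/-- **The doors at 3 at ranks 2 AND 3 side by side** (g6's `y² = x³ − 27·55²` and `y² = x³ − 27·2465²`): for each
`r ∈ {2, 3}` an elliptic curve over `ℚ` of rank `r` with `t_3 = 0` and `corank Sel_{3^∞} = r`, by `3`-descent alone.
[cite: Jeong2019RankExactlyTwoII, Prop. 3.5] -/
theorem exists_door_at_three_of_le (r : ℕ) (h2 : 2 ≤ r) (h3 : r ≤ 3) :
    ∃ W : WeierstrassCurve ℚ, W.IsElliptic ∧ W.mordellWeilRank = r ∧ W.shaCorank 3 = 0 ∧ W.selmerCorank 3 = r := by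
  rcases Nat.lt_or_ge r 3 with hlt | hge
  · have hr : r = 2 := by omega
    subst hr
    exact ⟨mordellCurve (-81675 : ℚ), XCubeSub81675.isElliptic_curve, XCubeSub81675.mordellWeilRank_curve,
      XCubeSub81675.shaCorank_three, XCubeSub81675.selmerCorank_three⟩
  · have hr : r = 3 := by omega
    subst hr
    exact ⟨mordellCurve (-27 * ((2465 : ℕ) : ℚ) ^ 2), Mordell2465.isElliptic_curve, Mordell2465.mordellWeilRank_curve.2,
      Mordell2465.shaCorank_three, Mordell2465.selmerCorank_three⟩

/-! ## §3 The cell `(E, 3, q)` read through T (the crux BY NAME) -/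

/-- **T at the rank-3 door at 3**: granting T, `t_q(E) = 0` at EVERY prime `q` — in particular `t_2(E) = 0`, which no
instrument in the tree decides for `E` (no rational `2`-torsion), and `t_5, t_{17}, t_{29} = 0` at the additive primes.
(Uses the crux BY NAME; unconditional at `q = 3`.) [cite: CohenPazuki2009, Thm. 2.1] -/
theorem shaCorank_2465_eq_zero_of_transfer (hT : FiniteShaComponentTransfer) (q : ℕ) [Fact q.Prime] :
    (mordellCurve (-27 * ((2465 : ℕ) : ℚ) ^ 2)).shaCorank q = 0 :=
  haveI := Mordell2465.isElliptic_curve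
  haveI : Fact (Nat.Prime 3) := ⟨Nat.prime_three⟩
  hT _ 3 q Mordell2465.shaCorank_three

/-- **T ⟹ `corank_{ℤ_q} Sel_{q^∞}(E/ℚ) = 3` at every prime `q`** (Greenberg's identity `corank Sel_{q^∞} = rank + t_q`,
tree theorem `selmerCorank_eq_mordellWeilRank_add_holds`). [cite: Greenberg1999LNM, §1 pp. 54–57] -/
theorem selmerCorank_2465_eq_three_of_transfer (hT : FiniteShaComponentTransfer) (q : ℕ) [Fact q.Prime] :
    (mordellCurve (-27 * ((2465 : ℕ) : ℚ) ^ 2)).selmerCorank q = 3 := by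
  haveI := Mordell2465.isElliptic_curve
  rw [(mordellCurve (-27 * ((2465 : ℕ) : ℚ) ^ 2)).selmerCorank_eq_mordellWeilRank_add_holds q,
    Mordell2465.mordellWeilRank_curve.2, shaCorank_2465_eq_zero_of_transfer hT q]

/-- **The transfer cell `(E, 3, q)` packaged** at rank 3: T's hypothesis holds at `p = 3` unconditionally; T's
conclusion at any other prime `q` is exactly what T asserts and nothing in the tree certifies.
[cite: CohenPazuki2009, Thm. 2.1] -/
theorem transfer_at_door_three_rank_three :
    (mordellCurve (-27 * ((2465 : ℕ) : ℚ) ^ 2)).shaCorank 3 = 0 ∧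
      (FiniteShaComponentTransfer → ∀ (q : ℕ) [Fact q.Prime],
        (mordellCurve (-27 * ((2465 : ℕ) : ℚ) ^ 2)).shaCorank q = 0 ∧
          (mordellCurve (-27 * ((2465 : ℕ) : ℚ) ^ 2)).selmerCorank q = 3) :=
  ⟨Mordell2465.shaCorank_three, fun hT q _ =>
    ⟨shaCorank_2465_eq_zero_of_transfer hT q, selmerCorank_2465_eq_three_of_transfer hT q⟩⟩

end Summit.BirchSwinnertonDyer.BirchSwinnertonDyer.Theorems.ShaPrimaryTransferDoorAtThreeRankThree
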